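import Literature.NumberTheory.GaloisRepresentations.LocalKroneckerWeberInertiaProofs
import Literature.NumberTheory.GaloisRepresentations.CyclotomicLevels
import Literature.NumberTheory.EllipticCurves.GreenbergSelmer
import Literature.NumberTheory.EllipticCurves.ZpExtension
import HarnessLib

/-!
# K6 crux `MuTransferX9` (stmt-BirchSwinnertonDyer-19276), stub `stub_selmerDualOdd` (skeleton v6),
# local lemma (L-p), target (Lp-2) TOTAL RAMIFICATION: the cyclotomic `ℤ_p`-extension of `ℚ` restricted
# to the INERTIA group at `p` is still onto `ℤ_p` — `I_p · Gal(ℚ̄/ℚ_∞) = Γ_ℚ`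

Cell `bsd-smallim`, seat `bsd-smallim-k6-lur-b` (gen 0).  HONEST FRAMING: theorems only (no definition, no
named fact, no `sorry`); nothing is asserted about any curve and nothing is booked.  Helper toward the
registered stub `stub_selmerDualOdd` of skeleton v6 (sha16 a90a661b046bb403) of crux 19276 — target (Lp-2)
of k6-c2's (L-p) architecture (STATUS 2026-08-26 17:30Z; plan g10 RULING 18:58Z): the hypothesis `hDN` of
k6-c2's one-double-coset Mackey formula `resSubgroup_cores_eq_cores_subgroupOf` (p457304,
`∀ g, ∃ d ∈ D, d⁻¹ * g ∈ N`) for `D = D_p` the decomposition group and `N = Gal(ℚ̄/ℚ_∞)` / `Gal(ℚ̄/ℚ_n)`,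
and the "depth element at `p`" of (Lp-3); closes nothing.

MATHEMATICS (Washington, *Introduction to Cyclotomic Fields*, Prop. 13.2–13.3 with Serre, *Local Fields*
IV §4 Prop. 17: `ℚ_∞/ℚ` is totally ramified at `p`): for the CYCLOTOMIC `ℤ_p`-extension `κ`
(`ZpExtension.IsCyclotomic`: `ker κ = χ_p⁻¹(μ(ℤ_p))`), `κ` factors through the `p`-adic cyclotomic character
`χ_p`, and `χ_p` restricted to the local inertia group `I_{ℚ_p} ≤ Γ_{ℚ_p}` is ONTO `ℤ_pˣ` (tree:
`adicCompletion_rat_exists_mem_absInertia_cyclotomicCharacter_eq`, local Kronecker–Weber) and compatible with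
restriction (`cyclotomicCharacter_absGaloisRestrict`).  Hence for every `g ∈ Γ_ℚ` there is `σ ∈ I_{ℚ_p}` with
`κ(res σ) = κ(g)` (`exists_mem_absInertia_apply_absGaloisRestrict_eq`), i.e. `res(σ)⁻¹ g ∈ ker κ`:
**`exists_mem_inertia_inv_mul_mem_kerSubgroup`**, **`exists_mem_decomp_inv_mul_mem_kerSubgroup`** (k6-c2's
requested signature VERBATIM, `D = GreenbergSelmer.decomp v`), the layer versions, `inertia_sup_kerSubgroup_eq_top`
/ `decomp_sup_kerSubgroup_eq_top`, the corollary **`exists_apply_absGaloisRestrict_ne_one`** (`∃ τ, κ(res τ) ≠ 1`,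
requested VERBATIM), a topological generator inside the local inertia (`exists_mem_absInertia_isTopGenerator`),
and DEPTH ELEMENTS of every depth inside the local inertia (`exists_mem_absInertia_mem_layerSubgroup_not_mem`:
`res τ ∈ Γ_m ∖ Γ_{m+1}`, the `g` of (Lp-3) / k6-g4's `…_of_depth` lemmas at the place `p` itself).

PARTITION (D-0054): X9 (A4) × p ∈ {5,7} (+ X10b∧¬Surj at 3) — helper toward `stub_selmerDualOdd`; closes none.

References: L. C. Washington, *Introduction to Cyclotomic Fields*, §13.1 and Prop. 13.2–13.3
[Washington1997]; J.-P. Serre, *Local Fields* (1979), Ch. IV §4 Prop. 17 [SerreLocalFields1979];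
J. Neukirch, *Algebraic Number Theory* (1999), Ch. II §9 (9.6) [NeukirchANT1999];
HOME/koly/MU-TRANSFER-PROOF.md (F6), §5 STEP 1.
-/

set_option linter.dupNamespace false
set_option autoImplicit false

noncomputable section

open scoped NumberField
open Field IsDedekindDomain NumberField
open Rat.HeightOneSpectrum
open Literature.NumberTheory.GaloisRepresentations
open Literature.NumberTheory.EllipticCurves

namespace Summit.BirchSwinnertonDyer.BirchSwinnertonDyer.Rank1Residual.SelmerDual

variable {p : ℕ} [Fact p.Prime] (κ : ZpExtension ℚ p)

/-- The place `v` of `ℚ` containing `p` IS the prime `p`: `primesEquiv v = p`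
(contrapositive of `Rat.natCast_not_mem_asIdeal_of_not_dvd`). [folklore] -/
theorem primesEquiv_eq_of_natCast_mem {v : HeightOneSpectrum (𝓞 ℚ)} (hv : ((p : ℕ) : 𝓞 ℚ) ∈ v.asIdeal) :
    ((primesEquiv v : Nat.Primes) : ℕ) = p := by
  have hdvd : ((primesEquiv v : Nat.Primes) : ℕ) ∣ p := by
    by_contra h
    exact Rat.natCast_not_mem_asIdeal_of_not_dvd h hv
  exact (Nat.prime_dvd_prime_iff_eq (primesEquiv v).2 Fact.out).mp hdvd

/-- **The cyclotomic `ℤ_p`-extension restricted to the local inertia group at `p` is onto**: for every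
`g ∈ Γ_ℚ` there is `σ ∈ I_{ℚ_p}` with `κ(res σ) = κ(g)` (`χ_p(I_{ℚ_p}) = ℤ_pˣ`, local Kronecker–Weber;
`ker κ = χ_p⁻¹(μ(ℤ_p))`). [cite: Washington1997, Prop. 13.2–13.3] [cite: SerreLocalFields1979, Ch. IV §4 Prop. 17] -/
theorem exists_mem_absInertia_apply_absGaloisRestrict_eq (hκ : κ.IsCyclotomic)
    (v : HeightOneSpectrum (𝓞 ℚ)) (hv : ((p : ℕ) : 𝓞 ℚ) ∈ v.asIdeal) (g : absoluteGaloisGroup ℚ) :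
    ∃ σ ∈ absInertia (v.adicCompletion ℚ),
      κ (absGaloisRestrict ℚ (v.adicCompletion ℚ) σ) = κ g := by
  obtain ⟨σ, hσI, hχ⟩ := adicCompletion_rat_exists_mem_absInertia_cyclotomicCharacter_eq p v
    (primesEquiv_eq_of_natCast_mem hv) (GaloisRep.cyclotomicCharacter ℚ p g)
  refine ⟨σ, hσI, ?_⟩
  set d := absGaloisRestrict ℚ (v.adicCompletion ℚ) σ with hd
  have hχd : GaloisRep.cyclotomicCharacter ℚ p d = GaloisRep.cyclotomicCharacter ℚ p g := by
    rw [hd, cyclotomicCharacter_absGaloisRestrict ℚ (v.adicCompletion ℚ) p σ, hχ]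
  have hone : (GaloisRep.cyclotomicCharacter ℚ p).toMonoidHom (d⁻¹ * g) = 1 := by
    rw [map_mul, map_inv]
    change (GaloisRep.cyclotomicCharacter ℚ p d)⁻¹ * GaloisRep.cyclotomicCharacter ℚ p g = 1
    rw [hχd, inv_mul_cancel]
  have hmem : d⁻¹ * g ∈ κ.kerSubgroup := by
    rw [hκ, Subgroup.mem_comap, hone]
    exact Subgroup.one_mem _
  rw [ZpExtension.mem_kerSubgroup, map_mul, map_inv, inv_mul_eq_one] at hmem
  exact hmem

/-- **(Lp-2), inertia form**: for every `g ∈ Γ_ℚ` there is `d` in the inertia group `I_p ≤ Γ_ℚ` of the chosen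
prime above `p` (`GreenbergSelmer.inertia v = res(I_{ℚ_p})`) with `d⁻¹ g ∈ Gal(ℚ̄/ℚ_∞)` — `I_p` maps ONTO
`Gal(ℚ_∞/ℚ)`, i.e. `ℚ_∞/ℚ` is totally ramified at `p`. [cite: Washington1997, Prop. 13.2–13.3] -/
theorem exists_mem_inertia_inv_mul_mem_kerSubgroup (hκ : κ.IsCyclotomic)
    (v : HeightOneSpectrum (𝓞 ℚ)) (hv : ((p : ℕ) : 𝓞 ℚ) ∈ v.asIdeal) (g : absoluteGaloisGroup ℚ) :
    ∃ d ∈ GreenbergSelmer.inertia v, d⁻¹ * g ∈ κ.kerSubgroup := by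
  obtain ⟨σ, hσI, hσ⟩ := exists_mem_absInertia_apply_absGaloisRestrict_eq κ hκ v hv g
  refine ⟨absGaloisRestrict ℚ (v.adicCompletion ℚ) σ, ⟨σ, hσI, rfl⟩, ?_⟩
  rw [ZpExtension.mem_kerSubgroup, map_mul, map_inv, inv_mul_eq_one]
  exact hσ

/-- **(Lp-2) TOTAL RAMIFICATION** (k6-c2's requested signature): for every `g ∈ Γ_ℚ` there is `d` in the
decomposition group `D_p = GreenbergSelmer.decomp v` with `d⁻¹ g ∈ Gal(ℚ̄/ℚ_∞)` — the hypothesis `hDN` of the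
one-double-coset Mackey formula `resSubgroup_cores_eq_cores_subgroupOf` for `(D, N) = (D_p, ker κ)`.
[cite: Washington1997, Prop. 13.2–13.3] [cite: NeukirchANT1999, Ch. II §9 Prop. (9.6)] -/
theorem exists_mem_decomp_inv_mul_mem_kerSubgroup (hκ : κ.IsCyclotomic)
    (v : HeightOneSpectrum (𝓞 ℚ)) (hv : ((p : ℕ) : 𝓞 ℚ) ∈ v.asIdeal) (g : absoluteGaloisGroup ℚ) :
    ∃ d ∈ GreenbergSelmer.decomp v, d⁻¹ * g ∈ κ.kerSubgroup := by
  obtain ⟨d, hd, h⟩ := exists_mem_inertia_inv_mul_mem_kerSubgroup κ hκ v hv g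
  exact ⟨d, GreenbergSelmer.inertia_le_decomp v hd, h⟩

/-- The same for the finite layers `N = Gal(ℚ̄/ℚ_n) = κ.layerSubgroup n ⊇ ker κ` (`hDN` for
`(D_p, Γ_n)`). [cite: Washington1997, Prop. 13.2–13.3] -/
theorem exists_mem_decomp_inv_mul_mem_layerSubgroup (hκ : κ.IsCyclotomic)
    (v : HeightOneSpectrum (𝓞 ℚ)) (hv : ((p : ℕ) : 𝓞 ℚ) ∈ v.asIdeal) (n : ℕ) (g : absoluteGaloisGroup ℚ) :
    ∃ d ∈ GreenbergSelmer.decomp v, d⁻¹ * g ∈ κ.layerSubgroup n := by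
  obtain ⟨d, hd, h⟩ := exists_mem_decomp_inv_mul_mem_kerSubgroup κ hκ v hv g
  exact ⟨d, hd, κ.kerSubgroup_le_layerSubgroup n h⟩

/-- The inertia-form for the layers. [cite: Washington1997, Prop. 13.2–13.3] -/
theorem exists_mem_inertia_inv_mul_mem_layerSubgroup (hκ : κ.IsCyclotomic)
    (v : HeightOneSpectrum (𝓞 ℚ)) (hv : ((p : ℕ) : 𝓞 ℚ) ∈ v.asIdeal) (n : ℕ) (g : absoluteGaloisGroup ℚ) :
    ∃ d ∈ GreenbergSelmer.inertia v, d⁻¹ * g ∈ κ.layerSubgroup n := by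
  obtain ⟨d, hd, h⟩ := exists_mem_inertia_inv_mul_mem_kerSubgroup κ hκ v hv g
  exact ⟨d, hd, κ.kerSubgroup_le_layerSubgroup n h⟩

/-- Subgroup form: `I_p ⊔ Gal(ℚ̄/ℚ_∞) = Γ_ℚ`. [cite: Washington1997, Prop. 13.2–13.3] -/
theorem inertia_sup_kerSubgroup_eq_top (hκ : κ.IsCyclotomic)
    (v : HeightOneSpectrum (𝓞 ℚ)) (hv : ((p : ℕ) : 𝓞 ℚ) ∈ v.asIdeal) :
    GreenbergSelmer.inertia v ⊔ κ.kerSubgroup = ⊤ := by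
  refine (Subgroup.eq_top_iff' _).mpr fun g => ?_
  obtain ⟨d, hd, h⟩ := exists_mem_inertia_inv_mul_mem_kerSubgroup κ hκ v hv g
  have hmul := Subgroup.mul_mem_sup hd h
  rwa [mul_inv_cancel_left] at hmul

/-- Subgroup form: `D_p ⊔ Gal(ℚ̄/ℚ_∞) = Γ_ℚ`. [cite: Washington1997, Prop. 13.2–13.3] -/
theorem decomp_sup_kerSubgroup_eq_top (hκ : κ.IsCyclotomic)
    (v : HeightOneSpectrum (𝓞 ℚ)) (hv : ((p : ℕ) : 𝓞 ℚ) ∈ v.asIdeal) :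
    GreenbergSelmer.decomp v ⊔ κ.kerSubgroup = ⊤ := by
  refine (Subgroup.eq_top_iff' _).mpr fun g => ?_
  obtain ⟨d, hd, h⟩ := exists_mem_decomp_inv_mul_mem_kerSubgroup κ hκ v hv g
  have hmul := Subgroup.mul_mem_sup hd h
  rwa [mul_inv_cancel_left] at hmul

/-- **Corollary (requested): `κ` is non-trivial on the decomposition group at `p`** — there is a local
`τ ∈ Γ_{ℚ_p}` with `κ(res τ) ≠ 1` (indeed one in the inertia group, next lemma).
[cite: Washington1997, Prop. 13.2–13.3] -/
theorem exists_apply_absGaloisRestrict_ne_one (hκ : κ.IsCyclotomic)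
    (v : HeightOneSpectrum (𝓞 ℚ)) (hv : ((p : ℕ) : 𝓞 ℚ) ∈ v.asIdeal) :
    ∃ τ : absoluteGaloisGroup (v.adicCompletion ℚ), κ (absGaloisRestrict ℚ (v.adicCompletion ℚ) τ) ≠ 1 := by
  obtain ⟨g, hg⟩ := κ.surjective (Multiplicative.ofAdd 1)
  have hg' : κ g = Multiplicative.ofAdd 1 := hg
  obtain ⟨σ, -, hσ⟩ := exists_mem_absInertia_apply_absGaloisRestrict_eq κ hκ v hv g
  refine ⟨σ, ?_⟩
  rw [hσ, hg']
  exact fun h => one_ne_zero (Multiplicative.ofAdd.injective (h.trans ofAdd_zero.symm))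

/-- The inertia version: `∃ τ ∈ I_{ℚ_p}, κ(res τ) ≠ 1` (k6-g4's hypothesis «`κ` non-trivial on `Γ_{K_v}`»
at the place `p` itself, witnessed inside inertia). [cite: Washington1997, Prop. 13.2–13.3] -/
theorem exists_mem_absInertia_apply_absGaloisRestrict_ne_one (hκ : κ.IsCyclotomic)
    (v : HeightOneSpectrum (𝓞 ℚ)) (hv : ((p : ℕ) : 𝓞 ℚ) ∈ v.asIdeal) :
    ∃ τ ∈ absInertia (v.adicCompletion ℚ), κ (absGaloisRestrict ℚ (v.adicCompletion ℚ) τ) ≠ 1 := by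
  obtain ⟨g, hg⟩ := κ.surjective (Multiplicative.ofAdd 1)
  have hg' : κ g = Multiplicative.ofAdd 1 := hg
  obtain ⟨σ, hσI, hσ⟩ := exists_mem_absInertia_apply_absGaloisRestrict_eq κ hκ v hv g
  refine ⟨σ, hσI, ?_⟩
  rw [hσ, hg']
  exact fun h => one_ne_zero (Multiplicative.ofAdd.injective (h.trans ofAdd_zero.symm))

/-- **A topological generator of `Gal(ℚ_∞/ℚ)` inside the local inertia group at `p`**: some
`τ ∈ I_{ℚ_p}` has `κ(res τ) = 1 ∈ ℤ_p` (`ZpExtension.IsTopGenerator`). [cite: Washington1997, Prop. 13.2–13.3] -/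
theorem exists_mem_absInertia_isTopGenerator (hκ : κ.IsCyclotomic)
    (v : HeightOneSpectrum (𝓞 ℚ)) (hv : ((p : ℕ) : 𝓞 ℚ) ∈ v.asIdeal) :
    ∃ τ ∈ absInertia (v.adicCompletion ℚ), κ.IsTopGenerator (absGaloisRestrict ℚ (v.adicCompletion ℚ) τ) := by
  obtain ⟨g, hg⟩ := κ.surjective (Multiplicative.ofAdd 1)
  have hg' : κ g = Multiplicative.ofAdd 1 := hg
  obtain ⟨σ, hσI, hσ⟩ := exists_mem_absInertia_apply_absGaloisRestrict_eq κ hκ v hv g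
  exact ⟨σ, hσI, hσ.trans hg'⟩

/-- **Depth elements at `p` of every depth**: for every `m` some `τ ∈ I_{ℚ_p}` has
`res τ ∈ Gal(ℚ̄/ℚ_m) ∖ Gal(ℚ̄/ℚ_{m+1})` (`κ(res τ) = p^m`; the element `g` of depth `m` at the place `p` in
k6-g4's `…_of_depth` lemmas and in (Lp-3)). [cite: Washington1997, Prop. 13.2–13.3] -/
theorem exists_mem_absInertia_mem_layerSubgroup_not_mem (hκ : κ.IsCyclotomic)
    (v : HeightOneSpectrum (𝓞 ℚ)) (hv : ((p : ℕ) : 𝓞 ℚ) ∈ v.asIdeal) (m : ℕ) :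
    ∃ τ ∈ absInertia (v.adicCompletion ℚ),
      absGaloisRestrict ℚ (v.adicCompletion ℚ) τ ∈ κ.layerSubgroup m ∧
        absGaloisRestrict ℚ (v.adicCompletion ℚ) τ ∉ κ.layerSubgroup (m + 1) := by
  obtain ⟨g, hg⟩ := κ.surjective (Multiplicative.ofAdd ((p : ℤ_[p]) ^ m))
  have hg' : κ g = Multiplicative.ofAdd ((p : ℤ_[p]) ^ m) := hg
  obtain ⟨σ, hσI, hσ⟩ := exists_mem_absInertia_apply_absGaloisRestrict_eq κ hκ v hv g
  refine ⟨σ, hσI, ?_, ?_⟩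
  · rw [ZpExtension.mem_layerSubgroup, hσ, hg', toAdd_ofAdd]
  · rw [ZpExtension.mem_layerSubgroup, hσ, hg', toAdd_ofAdd,
      pow_dvd_pow_iff PadicInt.irreducible_p.ne_zero PadicInt.irreducible_p.not_isUnit]
    omega

/-- The same read in `Γ_ℚ`: depth elements inside `GreenbergSelmer.inertia v`. [cite: Washington1997, Prop. 13.2–13.3] -/
theorem exists_mem_inertia_mem_layerSubgroup_not_mem (hκ : κ.IsCyclotomic)
    (v : HeightOneSpectrum (𝓞 ℚ)) (hv : ((p : ℕ) : 𝓞 ℚ) ∈ v.asIdeal) (m : ℕ) :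
    ∃ d ∈ GreenbergSelmer.inertia v, d ∈ κ.layerSubgroup m ∧ d ∉ κ.layerSubgroup (m + 1) := by
  obtain ⟨τ, hτI, h1, h2⟩ := exists_mem_absInertia_mem_layerSubgroup_not_mem κ hκ v hv m
  exact ⟨_, ⟨τ, hτI, rfl⟩, h1, h2⟩

end Summit.BirchSwinnertonDyer.BirchSwinnertonDyer.Rank1Residual.SelmerDual

end
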